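import Summits.ValiantsHypothesis.ValiantsHypothesis.Theorems.BarrierLeverTransversalMinorLayoutsRankEightCellFourA

/-!
# Route BarrierLever — item `TransversalLayoutsRankLeEight` (stmt-ValiantsHypothesis-19933):
# the locked cell with eight faces at height 4, part B — the four-path and the dispatcher

Helper file (`--supports stmt-ValiantsHypothesis-19933`; cell valiant-natproofs, rung V4, 𝒟-side of
door (c); seat val-np-p1 gen 8).  Completes the cell `(4, 8)` of the bounded engine:
* `good_path_h4_r8` — the `4`-PATH (class sizes `2, 3, 5, 6`) against its only locked partner, the
  solid triangle (`lowerFamily_eight_no_degree_two_three`; certificate `path4_v_simplex`);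
* `good_threeEdges_h4_r8` — the dispatcher: a complex with eight faces using all four coordinates
  is the `4`-claw plus three distinct edges (`image_eq_of_claw_three_edges_of_le_two`), i.e. a star
  (a vertex on all three edges), a triangle graph plus a point (the edges span three vertices) or
  a four-path (two of the edges are disjoint and the third joins them).

WHAT THIS IS NOT: one cell of a bounded-rank slice of TT; nothing on TT / 19930 in general, on crux
stmt-ValiantsHypothesis-14610, or on `VP` versus `VNP`.
-/

-- layout Summits/ValiantsHypothesis/ValiantsHypothesis forces the duplicated namespace component
set_option linter.dupNamespace false

open Matrix Finset

namespace Summit.ValiantsHypothesis.ValiantsHypothesis.Theorems.BarrierLever.FiniteCheck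

open Summit.ValiantsHypothesis.ValiantsHypothesis.Theorems.BarrierLever.Compression
open Summit.ValiantsHypothesis.ValiantsHypothesis.Theorems.BarrierLever.PriorityPeeling

/-! ## 1. The four-path -/

/-- **Cell `(4, 8)`, path case.**  Rows `∅`, singletons, `f = {v₁,v₂}`, `k = {v₂,v₃}`,
`g = {v₃,v₄}`; a vertex of degree two and one of degree three on the row side; then the column side
is a solid triangle and the certificate `path4_v_simplex` applies. -/
theorem good_path_h4_r8 (u w : Fin 8 → Finset (Fin 4)) (hu : Function.Injective u)
    (hw : Function.Injective w) (hlw : IsLowerSet (Set.range w))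
    (v₁ v₂ v₃ v₄ : Fin 4) (h12 : v₁ ≠ v₂) (h13 : v₁ ≠ v₃) (h14 : v₁ ≠ v₄) (h23 : v₂ ≠ v₃)
    (h24 : v₂ ≠ v₄) (h34 : v₃ ≠ v₄)
    (hrows : ∀ i, (u i).card ≤ 1 ∨ u i = {v₁, v₂} ∨ u i = {v₂, v₃} ∨ u i = {v₃, v₄})
    (x₂ x₃ : Fin 4) (hd2 : (Finset.univ.filter fun i => x₂ ∈ u i).card = 2)
    (hd3 : (Finset.univ.filter fun i => x₃ ∈ u i).card = 3)
    (hbig : ∃ x ∈ Finset.univ.image w, 2 ≤ x.card)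
    (hclash : ∀ (a c : Fin 4), (Finset.univ.filter fun i => a ∈ u i).card ≠
      (Finset.univ.filter fun j => c ∈ w j).card) :
    ∃ H : Matrix (Fin (4 + 4)) (Fin (4 + 4)) ℂ, (Matrix.of fun i j : Fin 8 => (H.submatrix
      (fun a : Fin 4 => if a ∈ u i then Fin.castAdd 4 a else Fin.natAdd 4 a)
      (fun c : Fin 4 => if c ∈ w j then Fin.natAdd 4 c else Fin.castAdd 4 c)).det).det ≠ 0 := by
  classical
  obtain ⟨hlow, hcard, hdegeq⟩ := image_lowerFamily w hw hlw
  obtain ⟨a, b, c, hab, hac, hbc, hall⟩ := lowerFamily_eight_no_degree_two_three _ hlow hcard hbig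
    (fun c hc => hclash x₂ c (by rw [hd2, ← hdegeq, hc]))
    (fun c hc => hclash x₃ c (by rw [hd3, ← hdegeq, hc]))
  obtain ⟨π', hπ'⟩ := cols_solid_h4 w a b c hab hac hbc
    (fun j => hall _ (Finset.mem_image.mpr ⟨j, Finset.mem_univ _, rfl⟩))
  obtain ⟨π, hπ⟩ := Equiv.Perm.exists_extending_pair (![v₁, v₂, v₃, v₄] : Fin 4 → Fin 4)
    (![0, 1, 2, 3] : Fin 4 → Fin 4) (vec4_injective v₁ v₂ v₃ v₄ h12 h13 h14 h23 h24 h34) (by decide)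
  have hp1 : π v₁ = 0 := hπ 0
  have hp2 : π v₂ = 1 := hπ 1
  have hp3 : π v₃ = 2 := hπ 2
  have hp4 : π v₄ = 3 := hπ 3
  refine good_of_ppDerivable_relabel u w _ _ hu hw π π' (fun i => ?_) hπ' path4_v_simplex_h4_derivable
  rcases hrows i with h1 | e | e | e
  · rcases Nat.lt_or_ge (u i).card 1 with h0 | h1'
    · rw [Finset.card_eq_zero.mp (show (u i).card = 0 by omega)]
      exact ⟨0, by simp⟩
    · obtain ⟨x, hx⟩ := Finset.card_eq_one.mp (le_antisymm h1 h1')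
      rw [hx, Finset.map_singleton]
      exact (by decide : ∀ z : Fin 4, ∃ i' : Fin 8, ({z} : Finset (Fin 4)) =
        (![∅, {0}, {1}, {2}, {3}, {0, 1}, {1, 2}, {2, 3}] : Fin 8 → Finset (Fin 4)) i') (π x)
  · rw [e]; exact ⟨5, by simp [Finset.map_insert, hp1, hp2]⟩
  · rw [e]; exact ⟨6, by simp [Finset.map_insert, hp2, hp3]⟩
  · rw [e]; exact ⟨7, by simp [Finset.map_insert, hp3, hp4]⟩

/-! ## 2. The dispatcher -/

/-- The other element of a pair through `v`. -/
theorem pair_other {h : ℕ} (e : Finset (Fin h)) (he : e.card = 2) (v : Fin h) (hv : v ∈ e) :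
    ∃ q : Fin h, q ≠ v ∧ e = {v, q} := by
  classical
  obtain ⟨q, hq⟩ := Finset.card_eq_one.mp
    (show (e.erase v).card = 1 by rw [Finset.card_erase_of_mem hv, he])
  have hqe : q ∈ e.erase v := by rw [hq]; simp
  exact ⟨q, (Finset.mem_erase.mp hqe).1, by rw [← Finset.insert_erase hv, hq]⟩

set_option maxHeartbeats 400000 in
/-- **Cell `(4, 8)`.**  A complex `u` with eight faces using all four coordinates, against an
eight-face complex `w` none of whose degrees equals a degree of `u`, is GOOD. -/
theorem good_threeEdges_h4_r8 (u w : Fin 8 → Finset (Fin 4)) (hu : Function.Injective u)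
    (hw : Function.Injective w) (hlu : IsLowerSet (Set.range u)) (hlw : IsLowerSet (Set.range w))
    (hfull : ∀ a : Fin 4, ∃ i, a ∈ u i)
    (hclash : ∀ (a c : Fin 4), (Finset.univ.filter fun i => a ∈ u i).card ≠
      (Finset.univ.filter fun j => c ∈ w j).card) :
    ∃ H : Matrix (Fin (4 + 4)) (Fin (4 + 4)) ℂ, (Matrix.of fun i j : Fin 8 => (H.submatrix
      (fun a : Fin 4 => if a ∈ u i then Fin.castAdd 4 a else Fin.natAdd 4 a)
      (fun c : Fin 4 => if c ∈ w j then Fin.natAdd 4 c else Fin.castAdd 4 c)).det).det ≠ 0 := by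
  classical
  have hle2 : ∀ i, (u i).card ≤ 2 :=
    face_card_le_two_of_full u hlu hfull (by norm_num) (by norm_num) (by norm_num)
  obtain ⟨e₁, e₂, e₃, h12, h13, h23, c1, c2, c3, himg⟩ :=
    image_eq_of_claw_three_edges_of_le_two u hu hlu hfull rfl hle2
  have hdegu := degree_of_claw_three_edges u hu e₁ e₂ e₃ h12 h13 h23 c1 c2 c3 himg
  -- how to read a row
  have hmemU : ∀ i, u i = e₁ ∨ u i = e₂ ∨ u i = e₃ ∨ (u i).card ≤ 1 := by
    intro i
    have hi : u i ∈ Finset.univ.image u := Finset.mem_image.mpr ⟨i, Finset.mem_univ _, rfl⟩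
    rw [himg, Finset.mem_insert, Finset.mem_insert, Finset.mem_insert, Finset.mem_insert,
      Finset.mem_image] at hi
    rcases hi with e | e | e | e | ⟨x, _, e⟩
    · exact Or.inl e
    · exact Or.inr (Or.inl e)
    · exact Or.inr (Or.inr (Or.inl e))
    · right; right; right; rw [e]; simp
    · right; right; right; rw [← e]; simp
  -- the column side has a member of size ≥ 2 (only five subsets of `Fin 4` have size ≤ 1)
  obtain ⟨hlow, hcard, -⟩ := image_lowerFamily w hw hlw
  have hbig : ∃ x ∈ Finset.univ.image w, 2 ≤ x.card := by
    by_contra hno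
    push Not at hno
    have hsub : Finset.univ.image w ⊆
        insert (∅ : Finset (Fin 4)) (Finset.univ.image fun a : Fin 4 => ({a} : Finset (Fin 4))) := by
      intro y hy
      have hy1 : y.card ≤ 1 := by have := hno y hy; omega
      rcases Nat.lt_or_ge y.card 1 with h0 | h1'
      · rw [Finset.card_eq_zero.mp (show y.card = 0 by omega)]
        exact Finset.mem_insert_self _ _
      · obtain ⟨c, rfl⟩ := Finset.card_eq_one.mp (show y.card = 1 by omega)
        exact Finset.mem_insert_of_mem (Finset.mem_image.mpr ⟨c, Finset.mem_univ _, rfl⟩)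
    have hle := Finset.card_le_card hsub
    have h5 : (insert (∅ : Finset (Fin 4))
        (Finset.univ.image fun a : Fin 4 => ({a} : Finset (Fin 4)))).card ≤ 5 := by
      refine (Finset.card_insert_le _ _).trans ?_
      rw [Finset.card_image_of_injective _ Finset.singleton_injective, Finset.card_univ,
        Fintype.card_fin]
    rw [hcard] at hle
    omega
  by_cases hA : ∃ v, v ∈ e₁ ∧ v ∈ e₂ ∧ v ∈ e₃
  · -- STAR with centre v
    obtain ⟨v, hv1, hv2, hv3⟩ := hA
    obtain ⟨q₁, hq1v, he1⟩ := pair_other e₁ c1 v hv1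
    obtain ⟨q₂, hq2v, he2⟩ := pair_other e₂ c2 v hv2
    obtain ⟨q₃, hq3v, he3⟩ := pair_other e₃ c3 v hv3
    have hq12 : q₁ ≠ q₂ := fun e => h12 (by rw [he1, he2, e])
    have hq13 : q₁ ≠ q₃ := fun e => h13 (by rw [he1, he3, e])
    have hq23 : q₂ ≠ q₃ := fun e => h23 (by rw [he2, he3, e])
    -- the four coordinates
    have huniv : ∀ x : Fin 4, x = v ∨ x = q₁ ∨ x = q₂ ∨ x = q₃ := by
      have hcard4 : ({v, q₁, q₂, q₃} : Finset (Fin 4)).card = 4 := by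
        rw [Finset.card_insert_of_notMem, Finset.card_insert_of_notMem, Finset.card_pair hq23]
        · simp only [Finset.mem_insert, Finset.mem_singleton, not_or]; exact ⟨hq12, hq13⟩
        · simp only [Finset.mem_insert, Finset.mem_singleton, not_or]
          exact ⟨hq1v.symm, hq2v.symm, hq3v.symm⟩
      have heq : ({v, q₁, q₂, q₃} : Finset (Fin 4)) = Finset.univ :=
        Finset.eq_univ_of_card _ (by rw [hcard4]; rfl)
      intro x
      have hx : x ∈ ({v, q₁, q₂, q₃} : Finset (Fin 4)) := by rw [heq]; exact Finset.mem_univ x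
      simpa using hx
    have hrows : ∀ i, u i = ∅ ∨ u i = {v} ∨ u i = {q₁} ∨ u i = {q₂} ∨ u i = {q₃} ∨
        u i = {v, q₁} ∨ u i = {v, q₂} ∨ u i = {v, q₃} := by
      intro i
      rcases hmemU i with e | e | e | h1
      · exact Or.inr (Or.inr (Or.inr (Or.inr (Or.inr (Or.inl (e.trans he1))))))
      · exact Or.inr (Or.inr (Or.inr (Or.inr (Or.inr (Or.inr (Or.inl (e.trans he2)))))))
      · exact Or.inr (Or.inr (Or.inr (Or.inr (Or.inr (Or.inr (Or.inr (e.trans he3)))))))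
      · rcases Nat.lt_or_ge (u i).card 1 with h0 | h1'
        · exact Or.inl (Finset.card_eq_zero.mp (by omega))
        · obtain ⟨x, hx⟩ := Finset.card_eq_one.mp (le_antisymm h1 h1')
          rcases huniv x with rfl | rfl | rfl | rfl
          · exact Or.inr (Or.inl hx)
          · exact Or.inr (Or.inr (Or.inl hx))
          · exact Or.inr (Or.inr (Or.inr (Or.inl hx)))
          · exact Or.inr (Or.inr (Or.inr (Or.inr (Or.inl hx))))
    have hdv : (Finset.univ.filter fun i => v ∈ u i).card = 4 := by
      rw [hdegu v]; simp [hv1, hv2, hv3]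
    have hq1_2 : q₁ ∉ e₂ := by
      rw [he2]; simp only [Finset.mem_insert, Finset.mem_singleton, not_or]; exact ⟨hq1v, hq12⟩
    have hq1_3 : q₁ ∉ e₃ := by
      rw [he3]; simp only [Finset.mem_insert, Finset.mem_singleton, not_or]; exact ⟨hq1v, hq13⟩
    have hq1_1 : q₁ ∈ e₁ := by rw [he1]; simp
    have hdq : (Finset.univ.filter fun i => q₁ ∈ u i).card = 2 := by
      rw [hdegu q₁]; simp [hq1_1, hq1_2, hq1_3]
    exact good_star_h4_r8 u w hu hw hlw v q₁ q₂ q₃ hq1v.symm hq2v.symm hq3v.symm hq12 hq13 hq23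
      hrows hdv hdq hbig hclash
  push Not at hA
  by_cases hB : (e₁ ∪ e₂ ∪ e₃).card = 3
  · -- TRIANGLE GRAPH on the three vertices of the union, plus the fourth coordinate
    obtain ⟨a, b, c, hab, hac, hbc, hUeq⟩ := Finset.card_eq_three.mp hB
    have hsubU : ∀ e, (e = e₁ ∨ e = e₂ ∨ e = e₃) → e ⊆ {a, b, c} := by
      intro e he
      rw [← hUeq]
      rcases he with rfl | rfl | rfl
      · exact Finset.subset_union_left.trans Finset.subset_union_left
      · exact Finset.subset_union_right.trans Finset.subset_union_left
      · exact Finset.subset_union_right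
    have hrows : ∀ i, (u i).card ≤ 1 ∨ ((u i).card = 2 ∧ u i ⊆ {a, b, c}) := by
      intro i
      rcases hmemU i with e | e | e | h1
      · right; rw [e]; exact ⟨c1, hsubU _ (Or.inl rfl)⟩
      · right; rw [e]; exact ⟨c2, hsubU _ (Or.inr (Or.inl rfl))⟩
      · right; rw [e]; exact ⟨c3, hsubU _ (Or.inr (Or.inr rfl))⟩
      · exact Or.inl h1
    -- a vertex of degree three: an element of e₁ lies in exactly two edges
    obtain ⟨p, hp1⟩ : e₁.Nonempty := by rw [← Finset.card_pos, c1]; omega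
    have hdeg3 : ∃ x₃, (Finset.univ.filter fun i => x₃ ∈ u i).card = 3 := by
      by_cases hp2 : p ∈ e₂
      · have hp3 : p ∉ e₃ := hA p hp1 hp2
        exact ⟨p, by rw [hdegu p]; simp [hp1, hp2, hp3]⟩
      · by_cases hp3 : p ∈ e₃
        · exact ⟨p, by rw [hdegu p]; simp [hp1, hp2, hp3]⟩
        · -- e₂, e₃ ⊆ {a,b,c} \ {p}, a 2-set: they coincide
          exfalso
          have hpU : p ∈ ({a, b, c} : Finset (Fin 4)) := hsubU _ (Or.inl rfl) hp1
          have hsub2 : e₂ ⊆ ({a, b, c} : Finset (Fin 4)).erase p := fun x hx =>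
            Finset.mem_erase.mpr ⟨fun e => hp2 (e ▸ hx), hsubU _ (Or.inr (Or.inl rfl)) hx⟩
          have hsub3 : e₃ ⊆ ({a, b, c} : Finset (Fin 4)).erase p := fun x hx =>
            Finset.mem_erase.mpr ⟨fun e => hp3 (e ▸ hx), hsubU _ (Or.inr (Or.inr rfl)) hx⟩
          have hU3 : ({a, b, c} : Finset (Fin 4)).card = 3 := by rw [← hUeq]; exact hB
          have hcardE : (({a, b, c} : Finset (Fin 4)).erase p).card = 2 := by
            rw [Finset.card_erase_of_mem hpU, hU3]
          have e2 := Finset.eq_of_subset_of_card_le hsub2 (by rw [hcardE, c2])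
          have e3 := Finset.eq_of_subset_of_card_le hsub3 (by rw [hcardE, c3])
          exact h23 (e2.trans e3.symm)
    obtain ⟨x₃, hx₃⟩ := hdeg3
    -- a vertex of degree one: the coordinate outside the union
    obtain ⟨d, hd⟩ : ∃ d : Fin 4, d ∉ ({a, b, c} : Finset (Fin 4)) := by
      by_contra hno
      push Not at hno
      have := Finset.card_le_card (show (Finset.univ : Finset (Fin 4)) ⊆ {a, b, c} from fun x _ => hno x)
      rw [Finset.card_univ, Fintype.card_fin, ← hUeq, hB] at this
      omega
    have hd1 : (Finset.univ.filter fun i => d ∈ u i).card = 1 := by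
      have n1 : d ∉ e₁ := fun h' => hd (hsubU _ (Or.inl rfl) h')
      have n2 : d ∉ e₂ := fun h' => hd (hsubU _ (Or.inr (Or.inl rfl)) h')
      have n3 : d ∉ e₃ := fun h' => hd (hsubU _ (Or.inr (Or.inr rfl)) h')
      rw [hdegu d]; simp [n1, n2, n3]
    exact good_triangleIso_h4_r8 u w hu hw hlw a b c hab hac hbc hrows x₃ d hx₃ hd1 hclash
  · -- PATH: two disjoint edges and a third joining them
    -- pairwise-intersecting edges without a common vertex span three vertices
    have hdisj : ∃ f g k : Finset (Fin 4), Disjoint f g ∧ k ≠ f ∧ k ≠ g ∧ f.card = 2 ∧ g.card = 2 ∧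
        k.card = 2 ∧ (∀ i, (u i).card ≤ 1 ∨ u i = f ∨ u i = k ∨ u i = g) ∧
        ∀ x, (Finset.univ.filter fun i => x ∈ u i).card =
          (if x ∈ f then 1 else 0) + (if x ∈ g then 1 else 0) + (if x ∈ k then 1 else 0) + 1 := by
      have hrowsE : ∀ i, (u i).card ≤ 1 ∨ u i = e₁ ∨ u i = e₂ ∨ u i = e₃ := by
        intro i
        rcases hmemU i with e | e | e | h1
        · exact Or.inr (Or.inl e)
        · exact Or.inr (Or.inr (Or.inl e))
        · exact Or.inr (Or.inr (Or.inr e))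
        · exact Or.inl h1
      by_cases d12 : Disjoint e₁ e₂
      · refine ⟨e₁, e₂, e₃, d12, h13.symm, h23.symm, c1, c2, c3, fun i => ?_, fun x => hdegu x⟩
        rcases hrowsE i with h1 | e | e | e
        · exact Or.inl h1
        · exact Or.inr (Or.inl e)
        · exact Or.inr (Or.inr (Or.inr e))
        · exact Or.inr (Or.inr (Or.inl e))
      by_cases d13 : Disjoint e₁ e₃
      · refine ⟨e₁, e₃, e₂, d13, h12.symm, h23, c1, c3, c2, fun i => ?_, fun x => ?_⟩
        · rcases hrowsE i with h1 | e | e | e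
          · exact Or.inl h1
          · exact Or.inr (Or.inl e)
          · exact Or.inr (Or.inr (Or.inl e))
          · exact Or.inr (Or.inr (Or.inr e))
        · rw [hdegu x]; ring
      by_cases d23 : Disjoint e₂ e₃
      · refine ⟨e₂, e₃, e₁, d23, h12, h13, c2, c3, c1, fun i => ?_, fun x => ?_⟩
        · rcases hrowsE i with h1 | e | e | e
          · exact Or.inl h1
          · exact Or.inr (Or.inr (Or.inl e))
          · exact Or.inr (Or.inl e)
          · exact Or.inr (Or.inr (Or.inr e))
        · rw [hdegu x]; ring
      -- all pairs meet, no common vertex: the union has three elements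
      exfalso
      obtain ⟨p, hp1, hp2⟩ := Finset.not_disjoint_iff.mp d12
      obtain ⟨q, hqp, he1⟩ := pair_other e₁ c1 p hp1
      obtain ⟨s, hsp, he2⟩ := pair_other e₂ c2 p hp2
      have hqs : q ≠ s := fun e => h12 (by rw [he1, he2, e])
      have hp3 : p ∉ e₃ := hA p hp1 hp2
      obtain ⟨x, hx1, hx3⟩ := Finset.not_disjoint_iff.mp d13
      obtain ⟨y, hy2, hy3⟩ := Finset.not_disjoint_iff.mp d23
      have hxq : x = q := by
        rw [he1, Finset.mem_insert, Finset.mem_singleton] at hx1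
        rcases hx1 with rfl | rfl
        · exact absurd hx3 hp3
        · rfl
      have hys : y = s := by
        rw [he2, Finset.mem_insert, Finset.mem_singleton] at hy2
        rcases hy2 with rfl | rfl
        · exact absurd hy3 hp3
        · rfl
      subst hxq; subst hys
      have he3 : e₃ = {x, y} := by
        symm
        apply Finset.eq_of_subset_of_card_le
        · intro z hz
          simp only [Finset.mem_insert, Finset.mem_singleton] at hz
          rcases hz with rfl | rfl
          · exact hx3
          · exact hy3
        · rw [c3, Finset.card_pair hqs]
      apply hB
      rw [he1, he2, he3]
      have : ({p, x} ∪ {p, y} ∪ {x, y} : Finset (Fin 4)) = {p, x, y} := by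
        ext z
        simp only [Finset.mem_union, Finset.mem_insert, Finset.mem_singleton]
        constructor
        · rintro (((hz | hz) | (hz | hz)) | (hz | hz))
          · exact Or.inl hz
          · exact Or.inr (Or.inl hz)
          · exact Or.inl hz
          · exact Or.inr (Or.inr hz)
          · exact Or.inr (Or.inl hz)
          · exact Or.inr (Or.inr hz)
        · rintro (hz | hz | hz)
          · exact Or.inl (Or.inl (Or.inl hz))
          · exact Or.inl (Or.inl (Or.inr hz))
          · exact Or.inr (Or.inr hz)
      rw [this, Finset.card_insert_of_notMem, Finset.card_pair hqs]
      simp only [Finset.mem_insert, Finset.mem_singleton, not_or]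
      exact ⟨hqp.symm, hsp.symm⟩
    obtain ⟨f, g, k, hfg, hkf, hkg, cf, cg, ck, hrowsP, hdegP⟩ := hdisj
    -- k meets f and g
    have hcov : ∀ z : Fin 4, z ∈ f ∨ z ∈ g := by
      have hcard4 : (f ∪ g).card = 4 := by rw [Finset.card_union_of_disjoint hfg, cf, cg]
      have heq : f ∪ g = Finset.univ := Finset.eq_univ_of_card _ (by rw [hcard4]; rfl)
      intro z
      have : z ∈ f ∪ g := by rw [heq]; exact Finset.mem_univ z
      exact Finset.mem_union.mp this
    obtain ⟨x, hxk, hxf⟩ : ∃ x ∈ k, x ∈ f := by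
      by_contra hno
      push Not at hno
      have hsub : k ⊆ g := fun z hz => (hcov z).resolve_left (hno z hz)
      exact hkg (Finset.eq_of_subset_of_card_le hsub (by rw [cg, ck]))
    obtain ⟨y, hyk, hyg⟩ : ∃ y ∈ k, y ∈ g := by
      by_contra hno
      push Not at hno
      have hsub : k ⊆ f := fun z hz => (hcov z).resolve_right (hno z hz)
      exact hkf (Finset.eq_of_subset_of_card_le hsub (by rw [cf, ck]))
    have hxy : x ≠ y := fun e => Finset.disjoint_left.mp hfg hxf (e ▸ hyg)
    have hkeq : k = {x, y} := by
      symm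
      apply Finset.eq_of_subset_of_card_le
      · intro z hz
        simp only [Finset.mem_insert, Finset.mem_singleton] at hz
        rcases hz with rfl | rfl
        · exact hxk
        · exact hyk
      · rw [ck, Finset.card_pair hxy]
    obtain ⟨v₁, hv1x, hfeq⟩ := pair_other f cf x hxf
    obtain ⟨v₄, hv4y, hgeq⟩ := pair_other g cg y hyg
    have hv1g : v₁ ∉ g := fun h' => Finset.disjoint_left.mp hfg (by rw [hfeq]; simp) h'
    have hv4f : v₄ ∉ f := fun h' => Finset.disjoint_left.mp hfg h' (by rw [hgeq]; simp)
    have h13 : v₁ ≠ y := fun e => hv1g (e ▸ hyg)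
    have h14 : v₁ ≠ v₄ := fun e => hv1g (by rw [hgeq, e]; simp)
    have h24 : x ≠ v₄ := fun e => hv4f (e ▸ hxf)
    have hrows : ∀ i, (u i).card ≤ 1 ∨ u i = {v₁, x} ∨ u i = {x, y} ∨ u i = {y, v₄} := by
      intro i
      rcases hrowsP i with h1 | e | e | e
      · exact Or.inl h1
      · exact Or.inr (Or.inl (by rw [e, hfeq, Finset.pair_comm]))
      · exact Or.inr (Or.inr (Or.inl (by rw [e, hkeq])))
      · exact Or.inr (Or.inr (Or.inr (by rw [e, hgeq])))
    have hv1k : v₁ ∉ k := by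
      rw [hkeq]; simp only [Finset.mem_insert, Finset.mem_singleton, not_or]; exact ⟨hv1x, h13⟩
    have hv1f : v₁ ∈ f := by rw [hfeq]; simp
    have hd2 : (Finset.univ.filter fun i => v₁ ∈ u i).card = 2 := by
      rw [hdegP v₁]; simp [hv1f, hv1g, hv1k]
    have hxg : x ∉ g := fun h' => Finset.disjoint_left.mp hfg hxf h'
    have hd3 : (Finset.univ.filter fun i => x ∈ u i).card = 3 := by
      rw [hdegP x]; simp [hxf, hxg, hxk]
    exact good_path_h4_r8 u w hu hw hlw v₁ x y v₄ hv1x h13 h14 hxy h24 hv4y.symm hrows v₁ x hd2 hd3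
      hbig hclash

end Summit.ValiantsHypothesis.ValiantsHypothesis.Theorems.BarrierLever.FiniteCheck
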